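import Mathlib.Algebra.BigOperators.Fin
import Mathlib.Data.Fin.Tuple.Basic
import Mathlib.Logic.Equiv.Fin.Basic
import Literature.Computability.Complexity.SymmetricCircuit
import Literature.Computability.Complexity.CircuitDAG
import HarnessLib

/-!
# Symmetric threshold circuits deciding `k`-WL equivalence with a fixed target, I: the DAG

Anderson–Dawar (2017, Thm 1 with §3) translate formulas of fixed-point logic with counting into
polynomial-size SYMMETRIC threshold circuits; the `k`-dimensional Weisfeiler–Leman refinement is the
prototype of such a formula (Cai–Fürer–Immerman 1992, §5), and "the input is `k`-WL-equivalent to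
the fixed graph `H`" is, for every `H`, decided by such circuits of size `m^{O(k)}`. This file writes
that circuit down on the tree's labelled DAGs (`GateDAG`, `CircuitDAG.lean`), for inputs consisting
of an `m × m` Boolean matrix `x` (read as `SimpleGraph.fromRel (x · · = true)`) TOGETHER WITH `m`
colour bits (a marked vertex subset), i.e. over `(Fin m × Fin m) ⊕ Fin m` — the input shape of the
materialised monadic guesses of the `PneNP/SymmetryBudget` window cruxes. The target enters only
through a `SymWL.Target m k T`: adjacency and colour bits (deciding, at construction time, the
sign of each literal) and two tables of COUNT THRESHOLDS `nA`, `nO`, which the semantics file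
instantiates with the true counts of the coloured `k`-WL colours of a target `(H, d)`.
Gate families (x-side indices `u v w : Fin m`, `ū : Fin k → Fin m` are renamed by the symmetry
action; target-side `w'`, `ī` never are):

* `ex u v` = `x(u,v) ∨ x(v,u)`, `nex u v` its negation, `ncol u` = `¬ colour(u)`;
* `mz ū ī` — round `0`: the coloured atomic type of `ū` in the input is that of `ī` in the target
  (a conjunction of `k² + k` literal wires chosen by the target's atomic type);
* `ag t ū ī w w'` — the new vertex `w` over `ū` matches `w'` over `ī` at round `t`: last-column
  literals, the colour literal of `w`, the `k` round-`t` matches of `ū[j ↦ w]` with `ī[j ↦ w']`;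
* `cge / cgt / ncgt / ceq t ū ī w'` — `#{w | ag t ū ī w w'}` is `≥ nA`, `≥ nA + 1`, not, `= nA t ī w'`
  (two padded majorities `MAJ_{2(m+1)}`, a negation, a conjunction);
* `ms t ū ī` — round `t + 1`: the round-`t` match and the `m` exact counts;
* `oge / ogt / nogt / oeq ī` — `#{ū | ū matches ī at the LAST round T} = nO ī` (padded majorities
  over the `m^k` tuples), and the OUTPUT `out`, their conjunction over `ī`.

Here: the gate type `SymWL.Node m k T`, gate functions (all in `tcBasis`), wiring, acyclicity
(`SymWL.level`), the renaming action `SymWL.Node.act` of `Sym(Fin m)` and the DAG `SymWL.wlDAG tgt`.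
Size and symmetry: `SymmetricWeisfeilerLemanSymmetry.lean`; semantics:
`SymmetricWeisfeilerLemanSemantics.lean`.

## References

* [AndersonDawar2016] M. Anderson, A. Dawar, *On symmetric circuits and fixed-point logics*,
  Theory Comput. Syst. 60 (2017), Thm 1, §3 (FPC, in particular `C^k`-types, to symmetric
  threshold circuits).
* [CaiFurerImmerman1992] Cai–Fürer–Immerman, Combinatorica 12 (1992), §5 (k-dim W-L refinement).
-/

namespace Literature.Computability.Complexity

open Finset

namespace SymWL

/-! ### Target data and gate indices -/

/-- The data of the fixed target read by the circuit: adjacency and colour bits (deciding the sign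
of each literal) and the count thresholds of the counting gates (`nA t ī w'`: how many new vertices
of the target realise, at round `t` over `ī`, the same value as `w'`; `nO ī`: how many target
tuples have the colour of `ī` at the last round). [cite: AndersonDawar2016, §3 (FPC to symmetric circuits)] -/
structure Target (m k T : ℕ) where
  /-- adjacency bits of the target graph -/
  adj : Fin m → Fin m → Bool
  /-- colour bits of the target -/
  col : Fin m → Bool
  /-- thresholds of the step counters -/
  nA : Fin T → (Fin k → Fin m) → Fin m → ℕ
  /-- thresholds of the output counters -/
  nO : (Fin k → Fin m) → ℕ

set_option synthInstance.maxSize 2048 in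
set_option synthInstance.maxHeartbeats 400000 in
/-- Gate indices of the `k`-WL matching circuit on `m` vertices with `T` rounds (see the module
docstring for the meaning of each family; `t` indexes rounds, `u v w ū` x-side vertices and tuples,
`w' ī` target-side ones). [cite: AndersonDawar2016, §3 (FPC to symmetric circuits)] -/
inductive Node (m k T : ℕ)
  | tt
  | ff
  | ex (u v : Fin m)
  | nex (u v : Fin m)
  | ncol (u : Fin m)
  | mz (ū ī : Fin k → Fin m)
  | ag (t : Fin T) (ū ī : Fin k → Fin m) (w w' : Fin m)
  | cge (t : Fin T) (ū ī : Fin k → Fin m) (w' : Fin m)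
  | cgt (t : Fin T) (ū ī : Fin k → Fin m) (w' : Fin m)
  | ncgt (t : Fin T) (ū ī : Fin k → Fin m) (w' : Fin m)
  | ceq (t : Fin T) (ū ī : Fin k → Fin m) (w' : Fin m)
  | ms (t : Fin T) (ū ī : Fin k → Fin m)
  | oge (ī : Fin k → Fin m)
  | ogt (ī : Fin k → Fin m)
  | nogt (ī : Fin k → Fin m)
  | oeq (ī : Fin k → Fin m)
  | out
  deriving DecidableEq, Fintype

namespace Node

variable {m k T : ℕ}

/-- Gate functions: constants, literal connectives, the conjunctions of the match gates, padded
majorities `MAJ_{2(m+1)}` / `MAJ_{2(m^k+1)}` for the counters, negations. [folklore] -/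
def fn : Node m k T → GateFn
  | tt => GateFn.and 0
  | ff => GateFn.or 0
  | ex _ _ => GateFn.or 2
  | nex _ _ => GateFn.not
  | ncol _ => GateFn.not
  | mz _ _ => GateFn.and (k * k + k)
  | ag _ _ _ _ _ => GateFn.and (k + 1 + k)
  | cge _ _ _ _ => GateFn.maj ((m + 1) + (m + 1))
  | cgt _ _ _ _ => GateFn.maj ((m + 1) + (m + 1))
  | ncgt _ _ _ _ => GateFn.not
  | ceq _ _ _ _ => GateFn.and 2
  | ms _ _ _ => GateFn.and (m + 1)
  | oge _ => GateFn.maj ((m ^ k + 1) + (m ^ k + 1))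
  | ogt _ => GateFn.maj ((m ^ k + 1) + (m ^ k + 1))
  | nogt _ => GateFn.not
  | oeq _ => GateFn.and 2
  | out => GateFn.and (m ^ k)

/-- The wires: inputs (matrix entries `inl (u,v)` and colour bits `inr u`) or gates. [folklore] -/
abbrev W (m k T : ℕ) : Type := ((Fin m × Fin m) ⊕ Fin m) ⊕ Node m k T

/-- The `{0,1,2}`-relation of two target vertices: `2` if equal, `1` if adjacent, `0` otherwise
(an entry of the target's atomic type). [folklore] -/
def relH (tgt : Target m k T) (i j : Fin m) : Fin 3 :=
  if i = j then 2 else if tgt.adj i j = true then 1 else 0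

/-- The wire asserting that two x-side vertices `a`, `b` stand in relation `r ∈ {0,1,2}`
(equality is decided at construction time; adjacency is the symmetrised entry or its negation).
[folklore] -/
def relW (a b : Fin m) (r : Fin 3) : W m k T :=
  if (r : ℕ) = 2 then (if a = b then Sum.inr tt else Sum.inr ff)
  else if a = b then Sum.inr ff
  else if (r : ℕ) = 1 then Sum.inr (ex a b) else Sum.inr (nex a b)

/-- The wire asserting that the colour bit of the x-side vertex `a` is `b`. [folklore] -/
def colW (a : Fin m) (b : Bool) : W m k T :=
  if b = true then Sum.inl (Sum.inr a) else Sum.inr (ncol a)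

/-- The wire carrying the match of `ū` with `ī` at round `t ≤ T`: the gate `mz ū ī` at round `0`,
the gate `ms t' ū ī` at round `t' + 1`. [folklore] -/
def Mw : Fin (T + 1) → (Fin k → Fin m) → (Fin k → Fin m) → W m k T
  | ⟨0, _⟩, ū, ī => Sum.inr (mz ū ī)
  | ⟨t + 1, h⟩, ū, ī => Sum.inr (ms ⟨t, by omega⟩ ū ī)

/-- The padding block of a threshold-`θ` counter of width `n + 1`: `n + 1 - θ` constant-true wires
followed by constant-false ones. [folklore] -/
def pad (n θ : ℕ) : Fin (n + 1) → W m k T :=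
  fun j => if (j : ℕ) + θ < n + 1 then Sum.inr tt else Sum.inr ff

/-- Argument wires of every gate (see the module docstring). [cite: AndersonDawar2016, §3 (FPC to symmetric circuits)] -/
def args (tgt : Target m k T) : (l : Node m k T) → Fin (fn l).1 → W m k T
  | tt => Fin.elim0
  | ff => Fin.elim0
  | ex u v => fun a => if (a : ℕ) = 0 then Sum.inl (Sum.inl (u, v)) else Sum.inl (Sum.inl (v, u))
  | nex u v => fun _ => Sum.inr (ex u v)
  | ncol u => fun _ => Sum.inl (Sum.inr u)
  | mz ū ī =>
      Fin.append
        (fun p : Fin (k * k) =>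
          relW (ū (finProdFinEquiv.symm p).1) (ū (finProdFinEquiv.symm p).2)
            (relH tgt (ī (finProdFinEquiv.symm p).1) (ī (finProdFinEquiv.symm p).2)))
        (fun j : Fin k => colW (ū j) (tgt.col (ī j)))
  | ag t ū ī w w' =>
      Fin.append
        (Fin.append (fun j : Fin k => relW (ū j) w (relH tgt (ī j) w'))
          (fun _ : Fin 1 => colW w (tgt.col w')))
        (fun j : Fin k => Mw t.castSucc (Function.update ū j w) (Function.update ī j w'))
  | cge t ū ī w' =>
      Fin.append (Fin.cons (Sum.inr ff) fun w => Sum.inr (ag t ū ī w w')) (pad m (tgt.nA t ī w'))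
  | cgt t ū ī w' =>
      Fin.append (Fin.cons (Sum.inr ff) fun w => Sum.inr (ag t ū ī w w')) (pad m (tgt.nA t ī w' + 1))
  | ncgt t ū ī w' => fun _ => Sum.inr (cgt t ū ī w')
  | ceq t ū ī w' => fun a => if (a : ℕ) = 0 then Sum.inr (cge t ū ī w') else Sum.inr (ncgt t ū ī w')
  | ms t ū ī => Fin.cons (Mw t.castSucc ū ī) fun w' => Sum.inr (ceq t ū ī w')
  | oge ī =>
      Fin.append (Fin.cons (Sum.inr ff) fun c => Mw (Fin.last T) (finFunctionFinEquiv.symm c) ī)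
        (pad (m ^ k) (tgt.nO ī))
  | ogt ī =>
      Fin.append (Fin.cons (Sum.inr ff) fun c => Mw (Fin.last T) (finFunctionFinEquiv.symm c) ī)
        (pad (m ^ k) (tgt.nO ī + 1))
  | nogt ī => fun _ => Sum.inr (ogt ī)
  | oeq ī => fun a => if (a : ℕ) = 0 then Sum.inr (oge ī) else Sum.inr (nogt ī)
  | out => fun c => Sum.inr (oeq (finFunctionFinEquiv.symm c))

/-- A level function increasing along the wires (six levels per round). [folklore] -/
def level : Node m k T → ℕ
  | tt => 0
  | ff => 0
  | ex _ _ => 0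
  | nex _ _ => 1
  | ncol _ => 1
  | mz _ _ => 2
  | ag t _ _ _ _ => 6 * t + 3
  | cge t _ _ _ => 6 * t + 4
  | cgt t _ _ _ => 6 * t + 4
  | ncgt t _ _ _ => 6 * t + 5
  | ceq t _ _ _ => 6 * t + 6
  | ms t _ _ => 6 * t + 8
  | oge _ => 6 * T + 3
  | ogt _ => 6 * T + 3
  | nogt _ => 6 * T + 4
  | oeq _ => 6 * T + 5
  | out => 6 * T + 6

/-- The level of the gate behind a match wire of round `t` is `6 t + 2`. [folklore] -/
theorem level_Mw (t : Fin (T + 1)) (ū ī : Fin k → Fin m) (l : Node m k T)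
    (h : Mw t ū ī = Sum.inr l) : level l = 6 * t + 2 := by
  rcases t with ⟨_ | t, ht⟩
  · simp only [Mw, Sum.inr.injEq] at h; subst h; simp [level]
  · simp only [Mw, Sum.inr.injEq] at h; subst h; simp [level]; omega

/-- Literal wires point to gates of level `≤ 1`. [folklore] -/
theorem level_relW (a b : Fin m) (r : Fin 3) (l : Node m k T) (h : relW a b r = Sum.inr l) :
    level l ≤ 1 := by
  simp only [relW] at h
  split_ifs at h <;> cases h <;> simp [level]

/-- Colour wires point to gates of level `≤ 1`. [folklore] -/
theorem level_colW (a : Fin m) (b : Bool) (l : Node m k T) (h : colW a b = Sum.inr l) : level l ≤ 1 := by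
  simp only [colW] at h
  split_ifs at h; cases h; simp [level]

/-- Padding wires point to constants. [folklore] -/
theorem level_pad (n θ : ℕ) (j : Fin (n + 1)) (l : Node m k T) (h : pad n θ j = Sum.inr l) :
    level l = 0 := by
  simp only [pad] at h
  split_ifs at h <;> cases h <;> simp [level]

/-- Wires of a padded counter `MAJ(ff, f₁, …, f_n ; padding)` point below level `L` as soon as
the counted wires do (`0 < L`). [folklore] -/
theorem level_lt_counter {n θ L : ℕ} (f : Fin n → W m k T)
    (hf : ∀ i l', f i = Sum.inr l' → level l' < L) (hL : 0 < L) (a : Fin ((n + 1) + (n + 1)))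
    (l' : Node m k T) (h : Fin.append (Fin.cons (Sum.inr ff) f) (pad n θ) a = Sum.inr l') :
    level l' < L := by
  induction a using Fin.addCases with
  | left i =>
    rw [Fin.append_left] at h
    revert h
    refine Fin.cases ?_ (fun w => ?_) i
    · intro h; simp only [Fin.cons_zero, Sum.inr.injEq] at h; subst h; simpa [level] using hL
    · intro h; rw [Fin.cons_succ] at h; exact hf w l' h
  | right j =>
    rw [Fin.append_right] at h
    have := level_pad _ _ _ _ h
    omega

/-- Wires point to gates of smaller level (acyclicity). [folklore] -/
theorem level_lt_of_args (tgt : Target m k T) {l l' : Node m k T} {a : Fin (fn l).1}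
    (h : args tgt l a = Sum.inr l') : level l' < level l := by
  cases l with
  | tt => exact a.elim0
  | ff => exact a.elim0
  | ex u v => (simp only [args] at h; split_ifs at h)
  | nex u v => simp only [args] at h; cases h; simp [level]
  | ncol u => simp only [args] at h; cases h
  | mz ū ī =>
    change Fin (k * k + k) at a
    simp only [args] at h
    induction a using Fin.addCases with
    | left p =>
      rw [Fin.append_left] at h
      have := level_relW _ _ _ _ h
      show level l' < 2
      omega
    | right j =>
      rw [Fin.append_right] at h
      have := level_colW _ _ _ h
      show level l' < 2
      omega
  | ag t ū ī w w' =>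
    change Fin (k + 1 + k) at a
    simp only [args] at h
    induction a using Fin.addCases with
    | left p =>
      rw [Fin.append_left] at h
      induction p using Fin.addCases with
      | left j =>
        rw [Fin.append_left] at h
        have := level_relW _ _ _ _ h
        show level l' < 6 * (t : ℕ) + 3
        omega
      | right j =>
        rw [Fin.append_right] at h
        have := level_colW _ _ _ h
        show level l' < 6 * (t : ℕ) + 3
        omega
    | right j =>
      rw [Fin.append_right] at h
      have := level_Mw _ _ _ _ h
      simp only [Fin.val_castSucc] at this
      show level l' < 6 * (t : ℕ) + 3
      omega
  | cge t ū ī w' =>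
    exact level_lt_counter (L := 6 * (t : ℕ) + 4) _
      (fun w l₁ h₁ => by cases h₁; show 6 * (t : ℕ) + 3 < _; omega) (by omega) a l' h
  | cgt t ū ī w' =>
    exact level_lt_counter (L := 6 * (t : ℕ) + 4) _
      (fun w l₁ h₁ => by cases h₁; show 6 * (t : ℕ) + 3 < _; omega) (by omega) a l' h
  | ncgt t ū ī w' => simp only [args] at h; cases h; simp [level]
  | ceq t ū ī w' => simp only [args] at h; split_ifs at h <;> cases h <;> simp [level]
  | ms t ū ī =>
    change Fin (m + 1) at a
    simp only [args] at h
    revert h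
    refine Fin.cases ?_ (fun w' => ?_) a
    · intro h
      rw [Fin.cons_zero] at h
      have := level_Mw _ _ _ _ h
      simp only [Fin.val_castSucc] at this
      show level l' < 6 * (t : ℕ) + 8
      omega
    · intro h
      simp only [Fin.cons_succ, Sum.inr.injEq] at h
      subst h; simp [level]
  | oge ī =>
    exact level_lt_counter (L := 6 * T + 3) _ (fun c l₁ h₁ => by
      have := level_Mw _ _ _ _ h₁; simp only [Fin.val_last] at this; omega) (by omega) a l' h
  | ogt ī =>
    exact level_lt_counter (L := 6 * T + 3) _ (fun c l₁ h₁ => by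
      have := level_Mw _ _ _ _ h₁; simp only [Fin.val_last] at this; omega) (by omega) a l' h
  | nogt ī => simp only [args] at h; cases h; simp [level]
  | oeq ī => simp only [args] at h; split_ifs at h <;> cases h <;> simp [level]
  | out => simp only [args] at h; cases h; simp [level]

/-- All gate functions lie in the threshold basis. [folklore] -/
theorem fn_mem_tcBasis (l : Node m k T) : fn l ∈ tcBasis := by
  cases l <;>
    first
    | exact acBasis_subset_tcBasis (Or.inl rfl)
    | exact acBasis_subset_tcBasis (Or.inr (Set.mem_iUnion.2 ⟨_, Or.inl rfl⟩))
    | exact acBasis_subset_tcBasis (Or.inr (Set.mem_iUnion.2 ⟨_, Or.inr rfl⟩))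
    | exact Or.inr (Set.mem_iUnion.2 ⟨_, rfl⟩)

/-- All gate functions are symmetric Boolean functions. [folklore] -/
theorem fn_isSymmetric (l : Node m k T) : (fn l).IsSymmetric :=
  isSymmetric_of_mem_tcBasis (fn_mem_tcBasis l)

/-! ### The action of vertex permutations on gates -/

/-- A permutation of the x-side vertices renames the x-side parameters of a gate; rounds and all
TARGET-side parameters (`ī`, `w'`) stay put. [cite: AndersonDawar2016, Def. 6 (induced automorphism)] -/
def act (ρ : Equiv.Perm (Fin m)) : Node m k T → Node m k T
  | tt => tt
  | ff => ff
  | ex u v => ex (ρ u) (ρ v)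
  | nex u v => nex (ρ u) (ρ v)
  | ncol u => ncol (ρ u)
  | mz ū ī => mz (fun j => ρ (ū j)) ī
  | ag t ū ī w w' => ag t (fun j => ρ (ū j)) ī (ρ w) w'
  | cge t ū ī w' => cge t (fun j => ρ (ū j)) ī w'
  | cgt t ū ī w' => cgt t (fun j => ρ (ū j)) ī w'
  | ncgt t ū ī w' => ncgt t (fun j => ρ (ū j)) ī w'
  | ceq t ū ī w' => ceq t (fun j => ρ (ū j)) ī w'
  | ms t ū ī => ms t (fun j => ρ (ū j)) ī
  | oge ī => oge ī
  | ogt ī => ogt ī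
  | nogt ī => nogt ī
  | oeq ī => oeq ī
  | out => out

/-- `act ρ⁻¹` inverts `act ρ`. [folklore] -/
theorem act_symm_act (ρ : Equiv.Perm (Fin m)) (l : Node m k T) : act ρ.symm (act ρ l) = l := by
  cases l <;> simp [act]

/-- The action as a permutation of the gate indices. [folklore] -/
def actEquiv (ρ : Equiv.Perm (Fin m)) : Node m k T ≃ Node m k T where
  toFun := act ρ
  invFun := act ρ.symm
  left_inv := act_symm_act ρ
  right_inv l := by simpa using act_symm_act ρ.symm l

/-- `actEquiv` is `act`. [folklore] -/
@[simp] theorem actEquiv_apply (ρ : Equiv.Perm (Fin m)) (l : Node m k T) : actEquiv ρ l = act ρ l :=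
  rfl

end Node

/-! ### The DAG -/

open Node

variable {m k T : ℕ}

/-- **The `k`-WL matching circuit against a fixed target, as a DAG** on the gate type `Node m k T`,
with output the conjunction `out` of the last-round counters. [cite: AndersonDawar2016, Thm 1 (FPC to symmetric circuits)] -/
noncomputable def wlDAG (tgt : Target m k T) : GateDAG ((Fin m × Fin m) ⊕ Fin m) (Node m k T) where
  fn := Node.fn
  args := Node.args tgt
  out := Sum.inr Node.out
  wf := Subrelation.wf (fun ⟨_, h⟩ => level_lt_of_args tgt h) (InvImage.wf level Nat.lt_wfRel.wf)

/-- The gate functions of the DAG. [folklore] -/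
theorem wlDAG_fn (tgt : Target m k T) (l : Node m k T) : (wlDAG tgt).fn l = Node.fn l := rfl

/-- The wiring of the DAG. [folklore] -/
theorem wlDAG_args (tgt : Target m k T) (l : Node m k T) : (wlDAG tgt).args l = Node.args tgt l := rfl

/-- The output of the DAG. [folklore] -/
theorem wlDAG_out (tgt : Target m k T) : (wlDAG tgt).out = Sum.inr Node.out := rfl

/-- All gate functions lie in `tcBasis`. [folklore] -/
theorem wlDAG_fn_mem_tcBasis (tgt : Target m k T) (l : Node m k T) : (wlDAG tgt).fn l ∈ tcBasis :=
  fn_mem_tcBasis l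

/-- All gate functions are symmetric. [folklore] -/
theorem wlDAG_fn_isSymmetric (tgt : Target m k T) (l : Node m k T) : ((wlDAG tgt).fn l).IsSymmetric :=
  fn_isSymmetric l

/-- The compiled straight-line circuit is over `tcBasis`. [folklore] -/
theorem compile_wlDAG_isOver (tgt : Target m k T) : (wlDAG tgt).compile.IsOver tcBasis :=
  GateDAG.compile_isOver _ (wlDAG_fn_mem_tcBasis tgt)

end SymWL

end Literature.Computability.Complexity
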